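/-
COR-CM (cell pub-hodgecm2, stage 2 of the Hodge ladder) — count-neutral kernel combinatorics (seat prover-pub-hodgecm2-b23-g51-0, binder
prover b23, gen 51; lane SYLOW TRANSFER, claim HOME/INBOX.md l.23329; blanket `Census/SylowTransfer*` l.23357).  Theorems only, in seat b09's
intrinsic model (consumed BY NAME, nothing restated); no definition, no certificate, no `decide`, no named fact, no geometry, no `sorry`.
`Interfaces.lean` (C1), every E term, B01 and `Transposition/*` are untouched.
HONEST FRAMING: `HC_CM` is NOT proved, here or anywhere in the tree; nothing here is a period or a headline.
-/
import Summits.HodgeConjecture.CorCM.Census.SylowTransferRoots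
import Summits.HodgeConjecture.CorCM.Census.IndexTwoCyclicOrderEight

/-!
# Sylow transfer, VII: every group of order `8·odd` with ABELIAN Sylow `2`-subgroup — `μ(G, c) = φ₂(G, c)` for EVERY central involution

For `|G| = 8m` with `m` odd a Sylow `2`-subgroup `P` has order `8`; if `P` is ABELIAN it is `ℤ/8` (part II, Burnside onto seat b09ʼs CYCLIC-SYLOW law),
`ℤ/4 × ℤ/2` (part VI: the roots character for the square involution, the coset sign for the two non-squares) or `(ℤ/2)³` (part IV: every
involution is a non-square) — TRICHOTOMY `isCyclic_or_exists_or_exponent_two` by the orders of elements, no classification theorem used.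
Hence (**`isLeast_card_gfaces_generate_fibreTwo_of_card_eq_eight_mul_odd_comm`**): for EVERY finite group of order `8·odd > 8` whose Sylow
`2`-subgroup is abelian and EVERY central involution `c ≠ 1`, `μ(G, c) = φ₂(G, c)`; with gen 50ʼs order-`8` census (`G` abelian of order `8`,
seat b09ʼs abelian law) also `|G| = 8` (**`…_comm'`**, `G : Type`).  The non-abelian Sylow types `D₄ ∋ c = r²` and `Q₈ ∋ c = −1` (conjugation in
the Frattini subgroup, no cyclic character: e.g. `X_p = ℤ/p ⋊ D₄`, `SL(2,3)·…`) remain OPEN at this order.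
All [folklore] bookkeeping over [Pohlmann1968, Thm 1] in the reading of [Milne1999, Prop. 2.1].

## References
* [Pohlmann1968] H. Pohlmann, Algebraic cycles on abelian varieties of complex multiplication type, Ann. of Math. 88 (1968), Thm 1.
* [Milne1999] J. S. Milne, Lefschetz motives and the Tate conjecture, Compositio Math. 117 (1999), Prop. 2.1, p. 54.
-/

namespace Summit.HodgeConjecture.CorCM.Census.SylowTransfer

open Finset
open Summit.HodgeConjecture.CorCM.Prior.AllgGroup.RfwfAllgGroup
open Summit.HodgeConjecture.CorCM.Census.BlockParity
open Summit.HodgeConjecture.CorCM.Census.Coinvariant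

noncomputable section

section Trichotomy

variable {G : Type*} [Group G]

/-! ## §1 Abelian subgroups of order `8`: the trichotomy by element orders -/

/-- In a subgroup of order `8` every element has order `1, 2, 4` or `8`. [folklore] -/
theorem orderOf_mem_of_card_eq_eight [Finite G] {P : Subgroup G} (hP : Nat.card P = 8) {y : G} (hy : y ∈ P) :
    orderOf y = 1 ∨ orderOf y = 2 ∨ orderOf y = 4 ∨ orderOf y = 8 := by
  have hdvd : orderOf y ∣ 2 ^ 3 := by rw [show (2 : ℕ) ^ 3 = 8 by norm_num, ← hP]; exact P.orderOf_dvd_natCard hy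
  obtain ⟨i, hi, h⟩ := (Nat.dvd_prime_pow Nat.prime_two).mp hdvd
  interval_cases i <;> simp [h]

/-- **TRICHOTOMY for an abelian subgroup of order `8`**: it is cyclic, or it contains commuting `u` of order `4` and an involution `x ∉ ⟨u⟩`
(`≅ ℤ/4 × ℤ/2`), or it has exponent two (`≅ (ℤ/2)³`). [folklore] -/
theorem isCyclic_or_exists_or_exponent_two [Finite G] {P : Subgroup G} (hP : Nat.card P = 8)
    (hcomm : ∀ a ∈ P, ∀ b ∈ P, a * b = b * a) :
    IsCyclic P ∨ (∃ u ∈ P, ∃ x ∈ P, orderOf u = 4 ∧ x * x = 1 ∧ x ≠ 1 ∧ x ∉ Subgroup.zpowers u) ∨ (∀ y ∈ P, y * y = 1) := by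
  by_cases hcyc : IsCyclic P
  · exact Or.inl hcyc
  have h8 : ∀ y ∈ P, orderOf y ≠ 8 := fun y hy h8 => hcyc (isCyclic_of_orderOf_eq_card (⟨y, hy⟩ : P) (by
    rw [← Subgroup.orderOf_coe, hP]; exact h8))
  by_cases h4 : ∃ u ∈ P, orderOf u = 4
  · obtain ⟨u, hu, hord⟩ := h4
    right; left
    -- an element outside `⟨u⟩`
    have hlt : ¬ (P ≤ Subgroup.zpowers u) := fun hle => by
      have := Subgroup.card_le_of_le hle
      rw [hP, Nat.card_zpowers, hord] at this
      omega
    obtain ⟨z, hzP, hz⟩ := Set.not_subset.mp hlt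
    have hz1 : z ≠ 1 := fun h => hz (h ▸ one_mem _)
    rcases orderOf_mem_of_card_eq_eight hP hzP with h | h | h | h
    · exact absurd (orderOf_eq_one_iff.mp h) hz1
    · exact ⟨u, hu, z, hzP, hord, by rw [← pow_two, ← h, pow_orderOf_eq_one], hz1, hz⟩
    · -- `z` of order `4`: `z²` is an involution; either it is outside `⟨u⟩`, or `z² = u²` and `z u⁻¹` is an involution outside `⟨u⟩`
      have hz2 : (z * z) * (z * z) = 1 := by rw [← pow_two, ← pow_two, ← pow_mul, show 2 * 2 = 4 by norm_num, ← h, pow_orderOf_eq_one]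
      have hz21 : z * z ≠ 1 := fun h1 => by
        have := orderOf_dvd_of_pow_eq_one (show z ^ 2 = 1 by rw [pow_two, h1])
        rw [h] at this
        omega
      by_cases hzu : z * z ∈ Subgroup.zpowers u
      · have hzz : z * z = u ^ 2 := IndexTwoCyclic.eq_pow_of_mem_zpowers_of_mul_self (n := 2) (by rw [hord]) hzu hz2 hz21
        refine ⟨u, hu, z * u⁻¹, mul_mem hzP (inv_mem hu), hord, ?_, fun h1 => hz ?_, fun hmem => hz ?_⟩
        · have hc : z * u⁻¹ = u⁻¹ * z := by
            rw [mul_inv_eq_iff_eq_mul, mul_assoc, ← hcomm u hu z hzP, ← mul_assoc, inv_mul_cancel, one_mul]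
          calc z * u⁻¹ * (z * u⁻¹) = z * (u⁻¹ * z) * u⁻¹ := by group
            _ = z * (z * u⁻¹) * u⁻¹ := by rw [← hc]
            _ = (z * z) * (u⁻¹ * u⁻¹) := by group
            _ = 1 := by rw [hzz, pow_two]; group
        · rw [mul_inv_eq_one] at h1
          rw [h1]; exact Subgroup.mem_zpowers u
        · have : z = z * u⁻¹ * u := by rw [inv_mul_cancel_right]
          rw [this]; exact mul_mem hmem (Subgroup.mem_zpowers u)
      · exact ⟨u, hu, z * z, mul_mem hzP hzP, hord, hz2, hz21, hzu⟩
    · exact absurd h (h8 z hzP)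
  · right; right
    intro y hy
    rcases orderOf_mem_of_card_eq_eight hP hy with h | h | h | h
    · rw [orderOf_eq_one_iff.mp h, mul_one]
    · rw [← pow_two, ← h, pow_orderOf_eq_one]
    · exact absurd ⟨y, hy, h⟩ h4
    · exact absurd h (h8 y hy)

end Trichotomy

variable {G : Type*} [Group G] [Fintype G] [DecidableEq G]

/-! ## §2 The law -/

omit [DecidableEq G] in
/-- For `|G| = 8m` with `m` odd a Sylow `2`-subgroup has order `8` and index `m`. [folklore] -/
theorem card_sylow_eq_eight (P : Sylow 2 G) {m : ℕ} (hG : Fintype.card G = 8 * m) (hm : Odd m) :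
    Nat.card (P : Subgroup G) = 8 ∧ (P : Subgroup G).index = m := by
  haveI : Fact (Nat.Prime 2) := ⟨Nat.prime_two⟩
  have hm0 : m ≠ 0 := fun h => by simp [h] at hm
  have h8 : Nat.card (P : Subgroup G) = 8 := by
    rw [Sylow.card_eq_multiplicity, Nat.card_eq_fintype_card, hG, Nat.factorization_mul (by norm_num) hm0, Finsupp.add_apply,
      Nat.factorization_eq_zero_of_not_dvd hm.not_two_dvd_nat, add_zero, show (8 : ℕ) = 2 ^ 3 by norm_num, Nat.factorization_pow,
      Finsupp.smul_apply, smul_eq_mul, Nat.prime_two.factorization_self, mul_one]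
  refine ⟨h8, ?_⟩
  have h := (P : Subgroup G).card_mul_index
  rw [h8, Nat.card_eq_fintype_card, hG] at h
  omega

/-- **EVERY GROUP OF ORDER `8·odd > 8` WITH ABELIAN SYLOW `2`-SUBGROUP, EVERY CENTRAL INVOLUTION: `μ(G, c) = φ₂(G, c)`.** [folklore] -/
theorem isLeast_card_gfaces_generate_fibreTwo_of_card_eq_eight_mul_odd_comm (c : G) {m : ℕ} (hG : Fintype.card G = 8 * m) (hm : Odd m)
    (hm1 : m ≠ 1) (P : Sylow 2 G) (hcomm : ∀ a ∈ (P : Subgroup G), ∀ b ∈ (P : Subgroup G), a * b = b * a)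
    (hc2 : c * c = 1) (hc1 : c ≠ 1) (hcen : ∀ y : G, y * c = c * y) :
    IsLeast {n : ℕ | ∃ S : Finset (CMF G c →₀ ℤ), (↑S ⊆ gfaceSet G c hc2) ∧ S.card = n ∧
      hodgeSpan c hc2 ≤ Submodule.span ℤ (pairSet c) ⊔ Submodule.span ℤ (translates c S)} (fibreTwo c hc2) := by
  obtain ⟨h8, hidx⟩ := card_sylow_eq_eight P hG hm
  have hidx1 : (P : Subgroup G).index ≠ 1 := by rw [hidx]; exact hm1
  rcases isCyclic_or_exists_or_exponent_two h8 hcomm with hcyc | ⟨u, hu, x, hx, hord, hx2, hx1, hxu⟩ | hexp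
  · exact (isLeast_card_gfaces_generate_fibreTwo_of_isCyclic_sylow c P hcyc (by rw [h8]; norm_num) hidx1 hc2 hc1 hcen).1
  · exact isLeast_card_gfaces_generate_fibreTwo_of_sylow_cyclicTimesTwo c P hu hx hxu hx2 hx1 (hcomm u hu x hx)
      (k := 2) (by rw [hord]; norm_num) le_rfl (by rw [h8, hord]) hidx1 hc2 hc1 hcen
  · exact isLeast_card_gfaces_generate_fibreTwo_of_sylow_exponent_two c P hexp hc2 hc1 hcen

/-- **… including `|G| = 8`** (`G : Type`; then `G = P` is abelian of order `8`, gen 50ʼs order-`8` census / seat b09ʼs abelian law). [folklore] -/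
theorem isLeast_card_gfaces_generate_fibreTwo_of_card_eq_eight_mul_odd_comm' {G : Type} [Group G] [Fintype G] [DecidableEq G] (c : G)
    {m : ℕ} (hG : Fintype.card G = 8 * m) (hm : Odd m) (P : Sylow 2 G)
    (hcomm : ∀ a ∈ (P : Subgroup G), ∀ b ∈ (P : Subgroup G), a * b = b * a)
    (hc2 : c * c = 1) (hc1 : c ≠ 1) (hcen : ∀ y : G, y * c = c * y) :
    IsLeast {n : ℕ | ∃ S : Finset (CMF G c →₀ ℤ), (↑S ⊆ gfaceSet G c hc2) ∧ S.card = n ∧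
      hodgeSpan c hc2 ≤ Submodule.span ℤ (pairSet c) ⊔ Submodule.span ℤ (translates c S)} (fibreTwo c hc2) := by
  by_cases hm1 : m = 1
  · subst hm1
    exact IndexTwoCyclic.isLeast_card_gfaces_generate_fibreTwo_of_card_eq_eight hc2 hc1 hcen (by rw [hG])
  · exact isLeast_card_gfaces_generate_fibreTwo_of_card_eq_eight_mul_odd_comm c hG hm hm1 P hcomm hc2 hc1 hcen

end

end Summit.HodgeConjecture.CorCM.Census.SylowTransfer
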